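import Summits.ResolutionOfSingularities.ResolutionOfSingularities.Theorems.AQSHeightTwoSlopeFiltration
import HarnessLib

/-!
# (o25) «F-AQS-T in the kernel», brick (α3): the first slope of a Newton set in lowest terms, and its ring-level reading

Route `ResolutionOfSingularities/WeightedInvariant`, door crux `HypersurfaceCentreConstruction`
(stmt-ResolutionOfSingularities-19897), ORDER (o25) of `res-L1-w43-plan-1` (lead `res-type-092`, design memo
`plan/tools/res-type-092/o25/O25-DESIGN.md` §1–§2): the Abramovich–Quek–Schober weights `(q, r)` of a plane-curve germ are
the lowest terms of the FIRST SLOPE `δ = min { α₀ / (ν − α₁) : α ∈ Δ, α₁ < ν }` of the Newton set `Δ ⊆ ℕ²` of a unit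
expansion with respect to a regular system of parameters `(x, y)` (`ν = ord f`, vertex `(0, ν)`).  Layer 1 is the
RING-FREE combinatorics of that minimum (everything about `Finset (Fin 2 → ℕ)`; index `0` = the `x`-exponent, weight `q`,
index `1` = the `y`-exponent, weight `r`):

* `exists_minSlope` — lowest-terms `(q, r)`, `0 < q`, `Nat.Coprime q r`, such that every exponent of `Δ` lies on or above
  the `(q, r)`-line through the vertex (`r ν ≤ q α₀ + r α₁`), some exponent with `α₁ < ν` lies ON it (the second face point
  of the (C)-certificate), with the denominator / numerator bounds `q ≤ ν − α₁`, `r ≤ α₀` at that exponent, and every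
  STEEPER pair `(q″, r″)` (`r q″ < r″ q`) has that exponent strictly below its line;
* `minSlope_unique` — two pairs with these properties for the same `Δ` coincide (lowest terms);

the ring-level reading (layer 2, section `Ring`, over res-type-092's (α1) file `AQSHeightTwoSlopeFiltration` and the K5
Newton API `LocalGameEFTNewton.*`; `S` regular local of dimension `2`, `(x, y) = 𝔪` in the pair form
`Ideal.span {x, y} = maximalIdeal S` of (α1)/(α4)): `mem_weightedMonomialIdeal_of_line` (membership in `𝒥_{rν}((x,y);(q,r))`
from the slope line), `not_mem_weightedMonomialIdeal_of_below` (unit monomials below a steeper line obstruct membership),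
`exists_slope_of_unitExpansion` (the AQS weights of a unit expansion: `1 ≤ q ≤ r` coprime, membership at level `r ν`,
non-membership for every steeper pair, second face point with `q ≤ ν − α₁`, `r ≤ α₀`), `slope_eq_of_unitExpansions`
(two unit expansions of the same `f` give the same lowest-terms slope).  Nothing here is a claim about Hironaka's
problem; AI-written, weaker than expert review.

References: D. Abramovich, M. H. Quek, B. Schober, arXiv:2507.01232v3, Def. 3.2–3.3, Constr. 1.3 [AbramovichQuekSchober2025];
H. Matsumura, *Commutative Ring Theory*, Thm. 14.4 / 16.2 (regular sequences are quasi-regular) [Matsumura1987].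
-/

namespace Summit.ResolutionOfSingularities.ResolutionOfSingularities.Theorems.AQSHeightTwo

set_option linter.dupNamespace false -- mandated namespace of this single-conjunct summit

/-! ## Cross-multiplication form of slope comparison -/

/-- For exponents under the vertex height `ν`, comparison of the slopes `α₀/(ν−α₁) ≤ β₀/(ν−β₁)` in `ℚ` is the
cross-multiplied comparison in `ℕ`. [folklore] -/
theorem slope_le_slope_iff {ν : ℕ} {α β : Fin 2 → ℕ} (hα : α 1 < ν) (hβ : β 1 < ν) :
    (α 0 : ℚ) / ((ν : ℚ) - α 1) ≤ (β 0 : ℚ) / ((ν : ℚ) - β 1) ↔ α 0 * (ν - β 1) ≤ β 0 * (ν - α 1) := by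
  have hα' : (0 : ℚ) < (ν : ℚ) - α 1 := by
    have : (α 1 : ℚ) < ν := by exact_mod_cast hα
    linarith
  have hβ' : (0 : ℚ) < (ν : ℚ) - β 1 := by
    have : (β 1 : ℚ) < ν := by exact_mod_cast hβ
    linarith
  rw [div_le_div_iff₀ hα' hβ']
  have e1 : ((ν - β 1 : ℕ) : ℚ) = (ν : ℚ) - β 1 := by push_cast [Nat.cast_sub hβ.le]; ring
  have e2 : ((ν - α 1 : ℕ) : ℚ) = (ν : ℚ) - α 1 := by push_cast [Nat.cast_sub hα.le]; ring
  constructor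
  · intro h
    have h' : ((α 0 * (ν - β 1) : ℕ) : ℚ) ≤ ((β 0 * (ν - α 1) : ℕ) : ℚ) := by
      push_cast [Nat.cast_sub hβ.le, Nat.cast_sub hα.le]
      linarith
    exact_mod_cast h'
  · intro h
    have h' : ((α 0 * (ν - β 1) : ℕ) : ℚ) ≤ ((β 0 * (ν - α 1) : ℕ) : ℚ) := by exact_mod_cast h
    push_cast [Nat.cast_sub hβ.le, Nat.cast_sub hα.le] at h'
    linarith

/-! ## The minimal slope in lowest terms -/

/-- **The first slope of a finite exponent set, in lowest terms.**  If some exponent of `Δ` has height `α₁ < ν`, there are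
coprime `q ≥ 1`, `r` with: every exponent of `Δ` on or above the `(q, r)`-line through `(0, ν)`; a witness exponent of
height `< ν` ON that line, with `q ≤ ν − α₁` and `r ≤ α₀` there; and every steeper pair `(q″, r″)` strictly above the
witness. [folklore] -/
theorem exists_minSlope (Δ : Finset (Fin 2 → ℕ)) (ν : ℕ) (hΔ : ∃ α ∈ Δ, α 1 < ν) :
    ∃ q r : ℕ, 0 < q ∧ Nat.Coprime q r ∧
      (∀ α ∈ Δ, r * ν ≤ q * α 0 + r * α 1) ∧
      ∃ α ∈ Δ, α 1 < ν ∧ q * α 0 + r * α 1 = r * ν ∧ q ≤ ν - α 1 ∧ r ≤ α 0 ∧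
        ∀ q'' r'' : ℕ, r * q'' < r'' * q → q'' * α 0 + r'' * α 1 < r'' * ν := by
  classical
  -- the exponents under the vertex height, a non-empty finite set
  set Δ' := Δ.filter (fun α => α 1 < ν) with hΔ'
  have hne : Δ'.Nonempty := by
    obtain ⟨α, hα, hα1⟩ := hΔ
    exact ⟨α, Finset.mem_filter.mpr ⟨hα, hα1⟩⟩
  -- a minimiser of the slope
  obtain ⟨β, hβ', hβmin⟩ := Δ'.exists_min_image (fun α : Fin 2 → ℕ => (α 0 : ℚ) / ((ν : ℚ) - α 1)) hne
  obtain ⟨hβ, hβ1⟩ := Finset.mem_filter.mp hβ'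
  -- lowest terms of `β₀ / (ν − β₁)`
  set q₀ := ν - β 1 with hq₀
  set r₀ := β 0 with hr₀
  have hq₀pos : 0 < q₀ := Nat.sub_pos_of_lt hβ1
  set g := Nat.gcd q₀ r₀ with hg
  have hgpos : 0 < g := Nat.gcd_pos_of_pos_left _ hq₀pos
  obtain ⟨q, hq⟩ : g ∣ q₀ := Nat.gcd_dvd_left _ _
  obtain ⟨r, hr⟩ : g ∣ r₀ := Nat.gcd_dvd_right _ _
  have hqpos : 0 < q := by
    rcases Nat.eq_zero_or_pos q with h | h
    · rw [h, mul_zero] at hq; omega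
    · exact h
  have hcop : Nat.Coprime q r := by
    have h := Nat.coprime_div_gcd_div_gcd (m := q₀) (n := r₀) hgpos
    have e1 : q₀ / Nat.gcd q₀ r₀ = q := by
      rw [← hg, hq, Nat.mul_div_cancel_left _ hgpos]
    have e2 : r₀ / Nat.gcd q₀ r₀ = r := by
      rw [← hg, hr, Nat.mul_div_cancel_left _ hgpos]
    rwa [e1, e2] at h
  -- `q α₀ + r α₁` versus `r ν`: cross-multiplication by `g`
  have key : ∀ α : Fin 2 → ℕ, α 1 < ν →
      ((β 0 : ℚ) / ((ν : ℚ) - β 1) ≤ (α 0 : ℚ) / ((ν : ℚ) - α 1) ↔ r * ν ≤ q * α 0 + r * α 1) := by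
    intro α hα1
    rw [slope_le_slope_iff hβ1 hα1]
    -- `β₀ (ν − α₁) ≤ α₀ (ν − β₁)` ↔ `g r (ν − α₁) ≤ α₀ g q` ↔ `r (ν − α₁) ≤ q α₀`
    rw [show β 0 = g * r from hr, show ν - β 1 = g * q from hq]
    constructor
    · intro h
      have h1 : g * (r * (ν - α 1)) ≤ g * (q * α 0) := by
        calc g * (r * (ν - α 1)) = g * r * (ν - α 1) := by ring
          _ ≤ α 0 * (g * q) := h
          _ = g * (q * α 0) := by ring
      have h2 : r * (ν - α 1) ≤ q * α 0 := Nat.le_of_mul_le_mul_left h1 hgpos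
      have h3 : r * (ν - α 1) + r * α 1 = r * ν := by
        rw [← Nat.mul_add, Nat.sub_add_cancel hα1.le]
      omega
    · intro h
      have h3 : r * (ν - α 1) + r * α 1 = r * ν := by
        rw [← Nat.mul_add, Nat.sub_add_cancel hα1.le]
      have h2 : r * (ν - α 1) ≤ q * α 0 := by omega
      calc g * r * (ν - α 1) = g * (r * (ν - α 1)) := by ring
        _ ≤ g * (q * α 0) := Nat.mul_le_mul_left _ h2
        _ = α 0 * (g * q) := by ring
  refine ⟨q, r, hqpos, hcop, ?_, β, hβ, hβ1, ?_, ?_, ?_, ?_⟩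
  · -- every exponent lies on or above the line
    intro α hα
    by_cases hα1 : α 1 < ν
    · exact (key α hα1).mp (hβmin α (Finset.mem_filter.mpr ⟨hα, hα1⟩))
    · push Not at hα1
      calc r * ν ≤ r * α 1 := Nat.mul_le_mul_left _ hα1
        _ ≤ q * α 0 + r * α 1 := Nat.le_add_left _ _
  · -- the witness lies ON the line: `q β₀ + r β₁ = r ν` from `β₀ = g r`, `ν − β₁ = g q`
    have h3 : r * (ν - β 1) + r * β 1 = r * ν := by
      rw [← Nat.mul_add, Nat.sub_add_cancel hβ1.le]
    have h4 : q * β 0 = r * (ν - β 1) := by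
      rw [show β 0 = g * r from hr, show ν - β 1 = g * q from hq]; ring
    omega
  · -- `q ≤ ν − β₁`
    have : q ∣ ν - β 1 := ⟨g, by rw [show ν - β 1 = g * q from hq]; ring⟩
    exact Nat.le_of_dvd hq₀pos this
  · -- `r ≤ β₀ = g r`
    have h5 : r ≤ g * r := Nat.le_mul_of_pos_left r hgpos
    rw [← hr] at h5
    exact h5
  · -- steeper pairs lie strictly above the witness
    intro q'' r'' hlt
    -- `q'' β₀ + r'' β₁ < r'' ν` ⟸ `q'' β₀ < r'' (ν − β₁)` ⟸ `q'' g r < r'' g q`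
    have h3 : r'' * (ν - β 1) + r'' * β 1 = r'' * ν := by
      rw [← Nat.mul_add, Nat.sub_add_cancel hβ1.le]
    have h4 : q'' * β 0 < r'' * (ν - β 1) := by
      rw [show β 0 = g * r from hr, show ν - β 1 = g * q from hq]
      calc q'' * (g * r) = g * (r * q'') := by ring
        _ < g * (r'' * q) := Nat.mul_lt_mul_of_pos_left hlt hgpos
        _ = r'' * (g * q) := by ring
    omega

/-- **Slope comparison through a witness.**  If all of `Δ` lies on or above the `(q, r)`-line through the vertex and some
exponent of height `< ν` lies ON the `(q', r')`-line, then `r/q ≤ r'/q'`, i.e. `r q' ≤ r' q`. [folklore] -/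
theorem mul_le_mul_of_line {Δ : Finset (Fin 2 → ℕ)} {ν q r q' r' : ℕ}
    (hle : ∀ α ∈ Δ, r * ν ≤ q * α 0 + r * α 1)
    (hw' : ∃ α ∈ Δ, α 1 < ν ∧ q' * α 0 + r' * α 1 = r' * ν) : r * q' ≤ r' * q := by
  obtain ⟨α, hα, hα1, hαeq⟩ := hw'
  have hA : 0 < ν - α 1 := Nat.sub_pos_of_lt hα1
  have e1 : r' * (ν - α 1) = q' * α 0 := by
    have h3 : r' * (ν - α 1) + r' * α 1 = r' * ν := by rw [← Nat.mul_add, Nat.sub_add_cancel hα1.le]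
    omega
  have i1 : r * (ν - α 1) ≤ q * α 0 := by
    have h3 : r * (ν - α 1) + r * α 1 = r * ν := by rw [← Nat.mul_add, Nat.sub_add_cancel hα1.le]
    have := hle α hα
    omega
  have h : r * q' * (ν - α 1) ≤ r' * q * (ν - α 1) := by
    calc r * q' * (ν - α 1) = q' * (r * (ν - α 1)) := by ring
      _ ≤ q' * (q * α 0) := Nat.mul_le_mul_left _ i1
      _ = q * (q' * α 0) := by ring
      _ = q * (r' * (ν - α 1)) := by rw [e1]
      _ = r' * q * (ν - α 1) := by ring
  exact Nat.le_of_mul_le_mul_right h hA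

/-- Coprime pairs with the same ratio are equal. [folklore] -/
theorem eq_of_coprime_of_mul_eq {q r q' r' : ℕ} (hq' : 0 < q') (hcop : Nat.Coprime q r)
    (hcop' : Nat.Coprime q' r') (heq : r * q' = r' * q) : q = q' ∧ r = r' := by
  have hdq : q ∣ q' := by
    have : q ∣ r * q' := ⟨r', by rw [heq]; ring⟩
    exact (Nat.Coprime.dvd_of_dvd_mul_left hcop this)
  have hdq' : q' ∣ q := by
    have : q' ∣ r' * q := ⟨r, by rw [← heq]; ring⟩
    exact (Nat.Coprime.dvd_of_dvd_mul_left hcop' this)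
  have hqq : q = q' := Nat.dvd_antisymm hdq hdq'
  refine ⟨hqq, ?_⟩
  rw [hqq] at heq
  have : q' * r = q' * r' := by rw [mul_comm q' r, mul_comm q' r']; exact heq
  exact Nat.eq_of_mul_eq_mul_left hq' this

/-- **Lowest terms are unique.**  Two coprime pairs `(q, r)`, `(q', r')` with `0 < q, q'` such that each has all of `Δ` on
or above its vertex line and a height-`< ν` witness ON its line coincide. [folklore] -/
theorem minSlope_unique {Δ : Finset (Fin 2 → ℕ)} {ν q r q' r' : ℕ} (hq' : 0 < q')
    (hcop : Nat.Coprime q r) (hcop' : Nat.Coprime q' r')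
    (hle : ∀ α ∈ Δ, r * ν ≤ q * α 0 + r * α 1) (hle' : ∀ α ∈ Δ, r' * ν ≤ q' * α 0 + r' * α 1)
    (hw : ∃ α ∈ Δ, α 1 < ν ∧ q * α 0 + r * α 1 = r * ν)
    (hw' : ∃ α ∈ Δ, α 1 < ν ∧ q' * α 0 + r' * α 1 = r' * ν) :
    q = q' ∧ r = r' :=
  eq_of_coprime_of_mul_eq hq' hcop hcop'
    (le_antisymm (mul_le_mul_of_line hle hw') (mul_le_mul_of_line hle' hw))

/-- **The first slope is at least `1` when every exponent has total degree `≥ ν`** (the Newton set of an element of order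
`ν`): then `q ≤ r`. [folklore] -/
theorem le_of_line_of_degree {Δ : Finset (Fin 2 → ℕ)} {ν q r : ℕ}
    (hdeg : ∀ α ∈ Δ, ν ≤ α 0 + α 1)
    (hw : ∃ α ∈ Δ, α 1 < ν ∧ q * α 0 + r * α 1 = r * ν) : q ≤ r := by
  obtain ⟨α, hα, hα1, hαeq⟩ := hw
  have hA : 0 < ν - α 1 := Nat.sub_pos_of_lt hα1
  have e1 : r * (ν - α 1) = q * α 0 := by
    have h3 : r * (ν - α 1) + r * α 1 = r * ν := by rw [← Nat.mul_add, Nat.sub_add_cancel hα1.le]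
    omega
  have hα0 : ν - α 1 ≤ α 0 := by have := hdeg α hα; omega
  -- `q (ν − α₁) ≤ q α₀ = r (ν − α₁)`
  have h : q * (ν - α 1) ≤ r * (ν - α 1) := by
    calc q * (ν - α 1) ≤ q * α 0 := Nat.mul_le_mul_left _ hα0
      _ = r * (ν - α 1) := e1.symm
  exact Nat.le_of_mul_le_mul_right h hA

/-! ## Ring level: unit expansions in a two-dimensional regular local ring -/

section Ring

open IsLocalRing Literature.AlgebraicGeometry.Resolution
open Summit.ResolutionOfSingularities.ResolutionOfSingularities.Theorems

universe u

variable {S : Type u} [CommRing S] [IsRegularLocalRing S] {x y : S}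
  (hxy : Ideal.span {x, y} = maximalIdeal S) (hdim : ringKrullDim S = (2 : ℕ))

include hxy in
/-- **Membership from the slope line.**  If `f = Σ_{α ∈ Δ} a_α x^{α₀} y^{α₁} + (𝔪^N)` (any coefficients) and every
exponent of `Δ` lies on or above the `(q, r)`-line through `(0, ν)`, then `f ∈ 𝒥_{rν}((x, y); (q, r))` as soon as
`r ν ≤ N` (`q, r ≥ 1`). [cite: Matsumura1987, Thm. 16.2] -/
theorem mem_weightedMonomialIdeal_of_line {f : S} {Δ : Finset (Fin 2 → ℕ)} {a : (Fin 2 → ℕ) → S} {N : ℕ}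
    (hr : f - ∑ α ∈ Δ, a α * ∏ i, ![x, y] i ^ α i ∈ maximalIdeal S ^ N)
    {q r ν : ℕ} (hq : 0 < q) (hr0 : 0 < r) (hline : ∀ α ∈ Δ, r * ν ≤ q * α 0 + r * α 1) (hN : r * ν ≤ N) :
    f ∈ weightedMonomialIdeal ![x, y] ![q, r] (r * ν) := by
  have hw : ∀ i, 0 < ![q, r] i := fun i => by fin_cases i <;> simpa
  refine LocalGameEFTNewton.mem_weightedMonomialIdeal_of_forall_le_weight ![x, y]
    (LocalGameEFTNewton.span_range_vecCons_eq hxy) ![q, r] hw hr ?_ hN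
  intro α hα
  rw [weight_two]
  exact hline α hα

include hxy hdim in
/-- **Non-membership for steeper slopes.**  With UNIT coefficients, if some exponent of `Δ` lies strictly below the
`(q″, r″)`-line through `(0, ν)`, then `f ∉ 𝒥_{r″ν}((x, y); (q″, r″))` when `r″ ν ≤ N` (unit monomials cannot hide in a
higher piece). [cite: Matsumura1987, Thm. 16.2] -/
theorem not_mem_weightedMonomialIdeal_of_below {f : S} {Δ : Finset (Fin 2 → ℕ)} {a : (Fin 2 → ℕ) → S} {N : ℕ}
    (hunit : ∀ α ∈ Δ, IsUnit (a α)) (hr : f - ∑ α ∈ Δ, a α * ∏ i, ![x, y] i ^ α i ∈ maximalIdeal S ^ N)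
    {q'' r'' ν : ℕ} (hq : 0 < q'') (hr0 : 0 < r'') (hbelow : ∃ α ∈ Δ, q'' * α 0 + r'' * α 1 < r'' * ν)
    (hN : r'' * ν ≤ N) :
    f ∉ weightedMonomialIdeal ![x, y] ![q'', r''] (r'' * ν) := by
  intro hf
  have hw : ∀ i, 0 < ![q'', r''] i := fun i => by fin_cases i <;> simpa
  have h := LocalGameEFTNewton.le_weight_of_mem_weightedMonomialIdeal ![x, y]
    (LocalGameEFTNewton.span_range_vecCons_eq hxy) hdim ![q'', r''] hw hunit hr hf hN
  obtain ⟨α, hα, hlt⟩ := hbelow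
  have := h α hα
  rw [weight_two] at this
  omega

include hxy hdim in
/-- **The AQS weights of a unit expansion.**  `S` regular local of dimension `2` with `𝔪 = (x, y)`, `f ∈ 𝔪^ν ∖ 𝔪^{ν+1}`,
`f = Σ_{α ∈ Δ} a_α x^{α₀} y^{α₁} + (𝔪^N)` a UNIT expansion (`ν < N`) with some exponent of height `α₁ < ν`.  Then with the
first slope `(q, r)` of `Δ` in lowest terms (`1 ≤ q ≤ r`, coprime): `f ∈ 𝒥_{rν}((x,y);(q,r))` provided `r ν ≤ N`; for every
STEEPER pair `(q″, r″)` with `r″ ν ≤ N`, `f ∉ 𝒥_{r″ν}((x,y);(q″,r″))`; and the face carries, besides possibly the vertex, an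
exponent of height `< ν` (the (C)-certificate's second face point), with `q ≤ ν − α₁ ≤ ν`, `r ≤ α₀`.
[cite: Matsumura1987, Thm. 16.2] -/
theorem exists_slope_of_unitExpansion {f : S} {Δ : Finset (Fin 2 → ℕ)} {a : (Fin 2 → ℕ) → S} {N ν : ℕ}
    (hunit : ∀ α ∈ Δ, IsUnit (a α)) (hr : f - ∑ α ∈ Δ, a α * ∏ i, ![x, y] i ^ α i ∈ maximalIdeal S ^ N)
    (hν : f ∈ maximalIdeal S ^ ν) (hν' : f ∉ maximalIdeal S ^ (ν + 1)) (hνN : ν < N)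
    (hΔ : ∃ α ∈ Δ, α 1 < ν) :
    ∃ q r : ℕ, 0 < q ∧ q ≤ r ∧ Nat.Coprime q r ∧
      (∀ α ∈ Δ, r * ν ≤ q * α 0 + r * α 1) ∧
      (r * ν ≤ N → f ∈ weightedMonomialIdeal ![x, y] ![q, r] (r * ν)) ∧
      (∀ q'' r'' : ℕ, 0 < q'' → r * q'' < r'' * q → r'' * ν ≤ N →
        f ∉ weightedMonomialIdeal ![x, y] ![q'', r''] (r'' * ν)) ∧
      ∃ α ∈ Δ, α 1 < ν ∧ q * α 0 + r * α 1 = r * ν ∧ q ≤ ν - α 1 ∧ r ≤ α 0 := by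
  obtain ⟨q, r, hq, hcop, hline, β, hβ, hβ1, hβeq, hqβ, hrβ, hsteep⟩ := exists_minSlope Δ ν hΔ
  have hdeg := (LocalGameEFTNewton.exists_degree_eq_of_not_mem_pow ![x, y]
    (LocalGameEFTNewton.span_range_vecCons_eq hxy) hdim hunit hr hν hν' hνN).1
  have hdeg' : ∀ α ∈ Δ, ν ≤ α 0 + α 1 := fun α hα => by
    have := hdeg α hα
    simpa [Fin.sum_univ_two] using this
  have hqr : q ≤ r := le_of_line_of_degree hdeg' ⟨β, hβ, hβ1, hβeq⟩
  have hr0 : 0 < r := lt_of_lt_of_le hq hqr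
  refine ⟨q, r, hq, hqr, hcop, hline, fun hN => mem_weightedMonomialIdeal_of_line hxy hr hq hr0 hline hN, ?_,
    β, hβ, hβ1, hβeq, hqβ, hrβ⟩
  intro q'' r'' hq'' hlt hN
  have hr'' : 0 < r'' := by
    rcases Nat.eq_zero_or_pos r'' with h | h
    · rw [h, zero_mul] at hlt; exact absurd hlt (Nat.not_lt_zero _)
    · exact h
  exact not_mem_weightedMonomialIdeal_of_below hxy hdim hunit hr hq'' hr'' ⟨β, hβ, hsteep q'' r'' hlt⟩ hN

include hxy hdim in
/-- **Expansion independence of the AQS weights.**  Two unit expansions of the same `f` (moduli `𝔪^N`, `𝔪^{N'}`), each with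
an exponent under the vertex height, whose first slopes in lowest terms are `(q, r)` and `(q', r')`, have `(q, r) = (q', r')`
as soon as `r ν ≤ N'` and `r' ν ≤ N` (each expansion sees the other's line). [cite: Matsumura1987, Thm. 16.2] -/
theorem slope_eq_of_unitExpansions {f : S} {Δ Δ' : Finset (Fin 2 → ℕ)} {a a' : (Fin 2 → ℕ) → S} {N N' ν : ℕ}
    (hunit : ∀ α ∈ Δ, IsUnit (a α)) (hr : f - ∑ α ∈ Δ, a α * ∏ i, ![x, y] i ^ α i ∈ maximalIdeal S ^ N)
    (hunit' : ∀ α ∈ Δ', IsUnit (a' α)) (hr' : f - ∑ α ∈ Δ', a' α * ∏ i, ![x, y] i ^ α i ∈ maximalIdeal S ^ N')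
    {q r q' r' : ℕ} (hq : 0 < q) (hr0 : 0 < r) (hq' : 0 < q') (hr0' : 0 < r')
    (hcop : Nat.Coprime q r) (hcop' : Nat.Coprime q' r')
    (hline : ∀ α ∈ Δ, r * ν ≤ q * α 0 + r * α 1) (hline' : ∀ α ∈ Δ', r' * ν ≤ q' * α 0 + r' * α 1)
    (hw : ∃ α ∈ Δ, α 1 < ν ∧ q * α 0 + r * α 1 = r * ν)
    (hw' : ∃ α ∈ Δ', α 1 < ν ∧ q' * α 0 + r' * α 1 = r' * ν)
    (hNr : r * ν ≤ N) (hNr' : r' * ν ≤ N) (hN'r : r * ν ≤ N') (hN'r' : r' * ν ≤ N') : q = q' ∧ r = r' := by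
  have hw2 : ∀ i, 0 < ![q, r] i := fun i => by fin_cases i <;> simpa
  have hw2' : ∀ i, 0 < ![q', r'] i := fun i => by fin_cases i <;> simpa
  -- `f ∈ 𝒥_{rν}(q,r)` read on `Δ'`: all of `Δ'` lies on or above the `(q,r)`-line; symmetrically for `(q',r')` on `Δ`
  have hf : f ∈ weightedMonomialIdeal ![x, y] ![q, r] (r * ν) := mem_weightedMonomialIdeal_of_line hxy hr hq hr0 hline hNr
  have hf' : f ∈ weightedMonomialIdeal ![x, y] ![q', r'] (r' * ν) :=
    mem_weightedMonomialIdeal_of_line hxy hr' hq' hr0' hline' hN'r'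
  have h1 : ∀ α ∈ Δ', r * ν ≤ q * α 0 + r * α 1 := fun α hα => by
    have := LocalGameEFTNewton.le_weight_of_mem_weightedMonomialIdeal ![x, y]
      (LocalGameEFTNewton.span_range_vecCons_eq hxy) hdim ![q, r] hw2 hunit' hr' hf hN'r α hα
    rwa [weight_two] at this
  have h2 : ∀ α ∈ Δ, r' * ν ≤ q' * α 0 + r' * α 1 := fun α hα => by
    have := LocalGameEFTNewton.le_weight_of_mem_weightedMonomialIdeal ![x, y]
      (LocalGameEFTNewton.span_range_vecCons_eq hxy) hdim ![q', r'] hw2' hunit hr hf' hNr' α hα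
    rwa [weight_two] at this
  exact eq_of_coprime_of_mul_eq hq' hcop hcop'
    (le_antisymm (mul_le_mul_of_line h1 hw') (mul_le_mul_of_line h2 hw))

end Ring

end Summit.ResolutionOfSingularities.ResolutionOfSingularities.Theorems.AQSHeightTwo
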